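import Summits.HubbardSuperconductivity.HubbardSuperconductivity.Theorems.CooperPairDMottWalkCooperPairDMottPairTrialCeilingGCDefect
import Summits.HubbardSuperconductivity.HubbardSuperconductivity.Theorems.CooperPairDMottWalkCooperPairDMottPairTrialCeilingBreathing
import Literature.MathematicalPhysics.QuantumLattice.PlaquettePairCouplings
import Literature.MathematicalPhysics.QuantumLattice.HubbardWave0RepulsiveProofs

/-!
# Route `CooperPairDMottWalk`, crux `CooperPairDMott` (stmt-HubbardSuperconductivity-1177):
# plaquette data for the pair ceiling — the gapped ground-space frame, the pair state, evenness

Support file for the stub `stub_pairTrialCeiling`. From the grand-canonical window hypothesis on one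
plaquette `h = hubbardTorus 2 2 1 U` ("`h − μN ≥ e₄ − 4μ + γ` on the orthogonal complement of the `(4,0)`
ground space `W`") this file extracts the data the torus argument consumes: an orthonormal frame `B` of
`W` (`dim W ≥ 1` columns, each a `(4, 0)` ground state of `h`) with the local defect inequality
`γ(‖v‖² − Re⟨v, BBᴴ v⟩) ≤ Re⟨v, (h − μN) v⟩ − (e₄ − 4μ)‖v‖²` (`plaquette_frame`, via
`re_form_defect_le_of_gap`), a unit ground state of the `(2, 0)` sector (`plaquette_pair`), and the
evenness of `h`, `N`, `S^z` (they lie in the even CAR subalgebra). Also three rewriting lemmas for the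
second quantisation `jwEmbed` (`jwEmbed_sub'`, `jwEmbed_mul'`, `jwEmbed_smul'`), proved at generic types
so that they can be used by `rw` at the concrete torus types where generic `map_sub`/`map_mul` instance
searches time out.

References: H. Tasaki (2020) App. A.2; E. Altman, A. Auerbach, PRB 65 (2002) 104508 §II.D. All statements
are [folklore]; no definition is introduced.
-/

set_option linter.dupNamespace false

noncomputable section

namespace Summit.HubbardSuperconductivity.HubbardSuperconductivity.Theorems.CooperPairDMottWalk

open Matrix Finset Literature.MathematicalPhysics.QuantumLattice
open Literature.Computability.AlgebraicComplexity (exists_orthonormalFrame)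
open scoped ComplexOrder

/-! ### Second quantisation: rewriting lemmas usable at concrete types -/

section Rewriting

variable {ι ι' : Type*} [LinearOrder ι] [Fintype ι] [LinearOrder ι'] [Fintype ι'] (e : ι ↪o ι')

/-- `e_*(a − b) = e_* a − e_* b`. [folklore] -/
theorem jwEmbed_sub' (a b : Matrix (Finset ι) (Finset ι) ℂ) : jwEmbed e (a - b) = jwEmbed e a - jwEmbed e b :=
  map_sub _ _ _

/-- `e_*(a b) = e_* a · e_* b`. [folklore] -/
theorem jwEmbed_mul' (a b : Matrix (Finset ι) (Finset ι) ℂ) : jwEmbed e (a * b) = jwEmbed e a * jwEmbed e b :=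
  map_mul _ _ _

/-- `e_*(c • a) = c • e_* a`. [folklore] -/
theorem jwEmbed_smul' (c : ℂ) (a : Matrix (Finset ι) (Finset ι) ℂ) : jwEmbed e (c • a) = c • jwEmbed e a := by
  rw [jwEmbed_apply, JWEmbed.embedFun_smul, jwEmbed_apply]

end Rewriting

/-! ### Plaquette data: the gapped ground space, its frame, the pair state -/

/-- **Unpacking the plaquette grand-canonical window.** From the hypothesis that `h − μN`
(`h = hubbardTorus 2 2 1 U`) is `≥ e₄ − 4μ + γ` on the orthogonal complement of the ground space
`W = {w ∈ szSector 4 0 | h w = e₄ w}` (`e₄` the `(4, 0)` sector energy), an orthonormal frame `B` of `W`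
(`k = dim W ≥ 1` columns, each a `(4,0)` ground state) with the local defect inequality
`γ(‖v‖² − Re⟨v, BBᴴ v⟩) ≤ Re⟨v, (h − μN) v⟩ − (e₄ − 4μ)‖v‖²`. [folklore] -/
theorem plaquette_frame (U : ℝ) {μ γ : ℝ}
    (hgap : ∀ v : Fock (Orb (FermionTorus 2 2)),
        (∀ w ∈ szSector (Λ := FermionTorus 2 2) 4 0,
          hubbardTorus 2 2 1 U *ᵥ w = (((hubbardTorus 2 2 1 U).minEnergyOn (szSector 4 0) : ℝ) : ℂ) • w →
            star w ⬝ᵥ v = 0) →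
        ((hubbardTorus 2 2 1 U).minEnergyOn (szSector 4 0) - 4 * μ + γ) * (star v ⬝ᵥ v).re ≤
          (star v ⬝ᵥ ((hubbardTorus 2 2 1 U - (μ : ℂ) • totalNumber) *ᵥ v)).re) :
    ∃ (k : ℕ) (B : Matrix (Finset (Orb (FermionTorus 2 2))) (Fin k) ℂ), 0 < k ∧ Bᴴ * B = 1 ∧
      (∀ j, (fun x => B x j) ∈ szSector (Λ := FermionTorus 2 2) 4 0 ∧
        hubbardTorus 2 2 1 U *ᵥ (fun x => B x j) =
          (((hubbardTorus 2 2 1 U).minEnergyOn (szSector 4 0) : ℝ) : ℂ) • (fun x => B x j)) ∧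
      ∀ v : Fock (Orb (FermionTorus 2 2)),
        γ * ((star v ⬝ᵥ v).re - (star v ⬝ᵥ ((B * Bᴴ) *ᵥ v)).re) ≤
          (star v ⬝ᵥ ((hubbardTorus 2 2 1 U - (μ : ℂ) • totalNumber) *ᵥ v)).re -
            ((hubbardTorus 2 2 1 U).minEnergyOn (szSector 4 0) - 4 * μ) * (star v ⬝ᵥ v).re := by
  set h := hubbardTorus 2 2 1 U with hh_def
  set e₄ : ℝ := h.minEnergyOn (szSector 4 0) with he₄
  have hh : h.IsHermitian := LiebThm1.hamiltonian_isHermitian _ 1 U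
  set W : Submodule ℂ (Fock (Orb (FermionTorus 2 2))) :=
    szSector 4 0 ⊓ Module.End.eigenspace (Matrix.toLin' h) (e₄ : ℂ) with hW
  have hmemW : ∀ w, w ∈ W ↔ w ∈ szSector (Λ := FermionTorus 2 2) 4 0 ∧ h *ᵥ w = (e₄ : ℂ) • w := by
    intro w
    rw [hW, Submodule.mem_inf, Module.End.mem_eigenspace_iff, Matrix.toLin'_apply]
  have hW0 : W ≠ ⊥ := by
    obtain ⟨⟨ψ, hψS, hψ0, hHψ⟩, -⟩ := szSector_groundState plaquetteGraph 1 U (n := 2)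
      (by rw [card_plaquetteSite]; norm_num)
    rw [Submodule.ne_bot_iff]
    exact ⟨ψ, (hmemW ψ).2 ⟨hψS, hHψ⟩, hψ0⟩
  obtain ⟨k, B, hk, hBB, hcol, hfix⟩ := exists_orthonormalFrame W
  have hkpos : 0 < k := by
    rw [hk, pos_iff_ne_zero, Ne, Submodule.finrank_eq_zero]
    exact hW0
  have hq : (h - (μ : ℂ) • totalNumber).IsHermitian := by
    have := isHermitian_hamiltonianWith plaquetteGraph 1 U μ
    rwa [hamiltonianWith_eq] at this
  have hWq : ∀ w ∈ W, (h - (μ : ℂ) • totalNumber) *ᵥ w = ((e₄ - 4 * μ : ℝ) : ℂ) • w := by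
    intro w hw
    obtain ⟨hwS, hw4⟩ := (hmemW w).1 hw
    have hN : totalNumber *ᵥ w = ((4 : ℕ) : ℂ) • w :=
      (LiebTwo.isNParticle_iff_totalNumber 4 w).1 ((mem_szSector_iff 4 0 w).1 hwS).1
    rw [sub_mulVec, smul_mulVec, hw4, hN, smul_smul, ← sub_smul]
    congr 1
    push_cast
    ring
  have hdef := re_form_defect_le_of_gap hq W hWq (fun v hv => by
    have := hgap v (fun w hwS hw4 => hv w ((hmemW w).2 ⟨hwS, hw4⟩))
    linarith) hcol hfix
  refine ⟨k, B, hkpos, hBB, fun j => (hmemW _).1 (hcol j), fun v => ?_⟩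
  have := hdef v
  linarith

/-- **The plaquette pair state**: a unit ground state `π` of the `(2, 0)` sector of the plaquette.
[folklore] -/
theorem plaquette_pair (U : ℝ) :
    ∃ π : Fock (Orb (FermionTorus 2 2)), star π ⬝ᵥ π = 1 ∧ π ∈ szSector (Λ := FermionTorus 2 2) 2 0 ∧
      hubbardTorus 2 2 1 U *ᵥ π = (((hubbardTorus 2 2 1 U).minEnergyOn (szSector 2 0) : ℝ) : ℂ) • π := by
  obtain ⟨π, hπ1, hπS, -, hHπ⟩ := exists_unit_isGroundStateInSector_plaquette U (n := 1) (by norm_num)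
  exact ⟨π, hπ1, hπS, hHπ⟩

/-! ### Evenness of the plaquette observables -/

/-- `N` is an even operator. [folklore] -/
theorem totalNumber_mem_carEvenSubalgebra {Λ : Type*} [LinearOrder Λ] [Fintype Λ] :
    (totalNumber : Matrix (Finset (Orb Λ)) (Finset (Orb Λ)) ℂ) ∈ carEvenSubalgebra (Finset.univ : Finset (Orb Λ)) := by
  rw [← orbs_univ]
  exact Subalgebra.sum_mem _ fun x _ => Subalgebra.sum_mem _ fun σ _ => numberOp_mem (Finset.mem_univ x) σ

/-- `S^z` is an even operator. [folklore] -/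
theorem spinZ_mem_carEvenSubalgebra {Λ : Type*} [LinearOrder Λ] [Fintype Λ] :
    (HubbardWave0.spinZ : Matrix (Finset (Orb Λ)) (Finset (Orb Λ)) ℂ) ∈ carEvenSubalgebra (Finset.univ : Finset (Orb Λ)) := by
  rw [← orbs_univ, HubbardWave0.spinZ]
  exact Subalgebra.smul_mem _ (Subalgebra.sum_mem _ fun x _ =>
    Subalgebra.sub_mem _ (numberOp_mem (Finset.mem_univ x) 0) (numberOp_mem (Finset.mem_univ x) 1)) _

/-- The plaquette Hamiltonian is an even operator. [folklore] -/
theorem hubbardTorus_two_mem_carEvenSubalgebra (U : ℝ) :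
    hubbardTorus 2 2 1 U ∈ carEvenSubalgebra (Finset.univ : Finset (Orb (FermionTorus 2 2))) := by
  rw [← orbs_univ]
  exact hamiltonian_mem_carEvenSubalgebra plaquetteGraph 1 U


/-! ### Registered form -/

/-- **Registered sub-goal `pairTrialCeiling_plaquetteFrame`** (closed form, as registered on the crux
item): the grand-canonical window of one plaquette yields an orthonormal frame of the `(4,0)` ground space
with the local defect inequality. [folklore] -/
theorem pairTrialCeiling_plaquetteFrame : ∀ (U : ℝ) {μ γ : ℝ}, (∀ v : Fock (Orb (FermionTorus 2 2)), (∀ w ∈ szSector (Λ := FermionTorus 2 2) 4 0, hubbardTorus 2 2 1 U *ᵥ w = (((hubbardTorus 2 2 1 U).minEnergyOn (szSector 4 0) : ℝ) : ℂ) • w → star w ⬝ᵥ v = 0) → ((hubbardTorus 2 2 1 U).minEnergyOn (szSector 4 0) - 4 * μ + γ) * (star v ⬝ᵥ v).re ≤ (star v ⬝ᵥ ((hubbardTorus 2 2 1 U - (μ : ℂ) • totalNumber) *ᵥ v)).re) → ∃ (k : ℕ) (B : Matrix (Finset (Orb (FermionTorus 2 2))) (Fin k) ℂ), 0 < k ∧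 Bᴴ * B = 1 ∧ (∀ j, (fun x => B x j) ∈ szSector (Λ := FermionTorus 2 2) 4 0 ∧ hubbardTorus 2 2 1 U *ᵥ (fun x => B x j) = (((hubbardTorus 2 2 1 U).minEnergyOn (szSector 4 0) : ℝ) : ℂ) • (fun x => B x j)) ∧ ∀ v : Fock (Orb (FermionTorus 2 2)), γ * ((star v ⬝ᵥ v).re - (star v ⬝ᵥ ((B * Bᴴ) *ᵥ v)).re) ≤ (star v ⬝ᵥ ((hubbardTorus 2 2 1 U - (μ : ℂ) • totalNumber) *ᵥ v)).re - ((hubbardTorus 2 2 1 U).minEnergyOn (szSector 4 0) - 4 * μ) * (star v ⬝ᵥ v).re :=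
  fun U _ _ hgap => plaquette_frame U hgap

end Summit.HubbardSuperconductivity.HubbardSuperconductivity.Theorems.CooperPairDMottWalk

end
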